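import Summits.QuantumFields.YangMills.Theorems.SwapVirialDeficitGnomonicDilation
import Mathlib.Analysis.SpecialFunctions.Gaussian.FourierTransform
import Mathlib.MeasureTheory.Measure.Haar.InnerProductSpace
import HarnessLib

/-!
# Route `SwapVirialDeficit` (YangMills): THE `z`-LETTER FACTOR OF THE TIP CORE — `∫⁻_{|z|≤R} w(z)·e^{−κ|z|²/(1+|z|²)} ≤ (2π/κ)^{3/2}` for `R ≤ 1`
# (cell ym-idea-1, skeleton ➎, `stub_core_tip`, socket (hCore); the shared `z`-factor of w2 g61's aligned-rotation assembly (STATUS 2026-09-01 02:11Z: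
# `Z(b) := ∫⁻_z 𝟙_{|z|≤2θ}·w(z)·e^{−(b/14400L⁶)|z|²/(1+|z|²)} ≤ (2π·14400L⁶/b)^{3/2}`); LEAD seat ym-line-sfw-p2 g100, free-hands support of ⟨stmt-QuantumFields-24197⟩
# `SwapVirialDeficit.SwapGluedStiffness`)

On `|z|² ≤ R² ≤ 1` the compression costs exactly a factor two, `|z|²/(1+|z|²) ≥ |z|²/2`, and `w = gnomonicWeight ≤ 1`; the remaining integral is the isotropic
Gaussian of `ℝ³`, `∫ e^{−(κ/2)|z|²} dz = (2π/κ)^{3/2}` (✓`GaussianFourier.integral_rexp_neg_mul_sq_norm` on `EuclideanSpace ℝ (Fin 3)` transported by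
✓`PiLp.volume_preserving_toLp`) — the EXACT `(2π/κ)^{3/2}`, so that the `z`-letter contributes `(2π/b)^{3/2}` to `(2π/b)^α` with a polynomial constant
(`κ = b/(14400L⁶)`: `(2π·14400L⁶/b)^{3/2}`).
* §1 `integral_exp_neg_mul_normSq3` (`= (π/κ)^{3/2}`), `integrable_exp_neg_mul_normSq3`, `lintegral_exp_neg_mul_normSq3`;
* §2 ★ `tipZ_factor_le` (indicator form) and `setLIntegral_tipZ_le` (restricted form): `≤ ofReal((2π/κ)^{3/2})` for `0 < κ`, `0 ≤ R ≤ 1`.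

HONEST LABEL: elementary Gaussian calculus; hLL ∕ (hCore) ∕ `stub_core_tip`, ⟨24197⟩ ∕ ⟨24194⟩ OPEN; own crux ⟨22884⟩ `LargeFieldMassRefinementTail` OPEN (blocked-on ⟨19935⟩);
the Yang–Mills mass gap is NOT proved; no summit is proved by a line.  THEOREMS ONLY (0 `def`, 0 `sorry`, no instance, no notation), standard axioms.
`--supports stmt-QuantumFields-24197`.  References: [folklore].
-/

set_option autoImplicit false

noncomputable section

open MeasureTheory Set Real
open scoped ENNReal

namespace Summit.QuantumFields.YangMills.Theorems.SwapVirialDeficit.SectorLaplace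

open Summit.QuantumFields.YangMills.Theorems.SwapVirialDeficit.Gnomonic (normSq3 gnomonicWeight gnomonicWeight_pos gnomonicWeight_le_one)

/-! ## §1 The isotropic Gaussian of `ℝ³` in the letters `normSq3` -/

/-- `‖toLp 2 z‖² = normSq3 z` on `EuclideanSpace ℝ (Fin 3)`. [folklore] -/
theorem norm_sq_toLp_fin_three (z : Fin 3 → ℝ) : ‖(WithLp.toLp 2 z : EuclideanSpace ℝ (Fin 3))‖ ^ 2 = normSq3 z := by
  rw [EuclideanSpace.real_norm_sq_eq]
  simp [normSq3]

/-- ★ §1 `∫_{Fin 3 → ℝ} e^{−κ·normSq3 z} dz = (π/κ)^{3/2}` for `κ > 0`. [folklore] -/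
theorem integral_exp_neg_mul_normSq3 {κ : ℝ} (hκ : 0 < κ) :
    ∫ z : Fin 3 → ℝ, Real.exp (-(κ * normSq3 z)) = (π / κ) ^ ((3 : ℝ) / 2) := by
  set f : EuclideanSpace ℝ (Fin 3) → ℝ := fun w => Real.exp (-κ * ‖w‖ ^ 2) with hf
  have h := (PiLp.volume_preserving_toLp (Fin 3)).integral_comp (MeasurableEquiv.toLp 2 (Fin 3 → ℝ)).measurableEmbedding f
  have key : ∀ z : Fin 3 → ℝ, f (WithLp.toLp 2 z) = Real.exp (-(κ * normSq3 z)) := by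
    intro z
    rw [hf]
    simp only [norm_sq_toLp_fin_three, neg_mul]
  have h' : ∫ z : Fin 3 → ℝ, Real.exp (-(κ * normSq3 z)) = ∫ w : EuclideanSpace ℝ (Fin 3), f w := by
    rw [← h]
    exact integral_congr_ae (Filter.Eventually.of_forall fun z => (key z).symm)
  rw [h', hf, GaussianFourier.integral_rexp_neg_mul_sq_norm hκ, finrank_euclideanSpace, Fintype.card_fin]
  norm_num

/-- The `ℝ³` Gaussian is integrable (`κ > 0`). [folklore] -/
theorem integrable_exp_neg_mul_normSq3 {κ : ℝ} (hκ : 0 < κ) : Integrable fun z : Fin 3 → ℝ => Real.exp (-(κ * normSq3 z)) := by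
  have hpos : 0 < ∫ z : Fin 3 → ℝ, Real.exp (-(κ * normSq3 z)) := by
    rw [integral_exp_neg_mul_normSq3 hκ]; positivity
  by_contra h
  rw [integral_undef h] at hpos
  exact lt_irrefl _ hpos

/-- §1 in `ℝ≥0∞`: `∫⁻ e^{−κ·normSq3 z} = ofReal((π/κ)^{3/2})`. [folklore] -/
theorem lintegral_exp_neg_mul_normSq3 {κ : ℝ} (hκ : 0 < κ) :
    ∫⁻ z : Fin 3 → ℝ, ENNReal.ofReal (Real.exp (-(κ * normSq3 z))) = ENNReal.ofReal ((π / κ) ^ ((3 : ℝ) / 2)) := by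
  rw [← integral_exp_neg_mul_normSq3 hκ,
    ofReal_integral_eq_lintegral_ofReal (integrable_exp_neg_mul_normSq3 hκ) (Filter.Eventually.of_forall fun z => (Real.exp_pos _).le)]

/-! ## §2 The compressed `z`-factor on the unit ball -/

/-- Pointwise: on `normSq3 z ≤ R² ≤ 1`, `w(z)·e^{−κ|z|²/(1+|z|²)} ≤ e^{−(κ/2)|z|²}` (`κ ≥ 0`). [folklore] -/
theorem tipZ_integrand_le {κ R : ℝ} (hκ : 0 ≤ κ) (hR0 : 0 ≤ R) (hR : R ≤ 1) {z : Fin 3 → ℝ} (hz : normSq3 z ≤ R ^ 2) :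
    gnomonicWeight z * Real.exp (-(κ * normSq3 z / (1 + normSq3 z))) ≤ Real.exp (-(κ / 2 * normSq3 z)) := by
  have hn0 : 0 ≤ normSq3 z := by unfold normSq3; positivity
  have hn1 : normSq3 z ≤ 1 := hz.trans (by nlinarith)
  have hcomp : κ / 2 * normSq3 z ≤ κ * normSq3 z / (1 + normSq3 z) := by
    rw [le_div_iff₀ (by linarith)]
    nlinarith [mul_nonneg hκ hn0]
  calc gnomonicWeight z * Real.exp (-(κ * normSq3 z / (1 + normSq3 z)))
      ≤ 1 * Real.exp (-(κ * normSq3 z / (1 + normSq3 z))) :=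
        mul_le_mul_of_nonneg_right (gnomonicWeight_le_one z) (Real.exp_pos _).le
    _ ≤ Real.exp (-(κ / 2 * normSq3 z)) := by rw [one_mul]; exact Real.exp_le_exp.2 (by linarith)

/-- ★ §2 **THE `z`-FACTOR** (indicator form): `∫⁻ 𝟙_{normSq3 z ≤ R²}·ofReal(w(z)·e^{−κ|z|²/(1+|z|²)}) ≤ ofReal((2π/κ)^{3/2})` for `κ > 0`, `R ≤ 1`. [folklore] -/
theorem tipZ_factor_le {κ R : ℝ} (hκ : 0 < κ) (hR0 : 0 ≤ R) (hR : R ≤ 1) :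
    ∫⁻ z : Fin 3 → ℝ, {z : Fin 3 → ℝ | normSq3 z ≤ R ^ 2}.indicator
        (fun z => ENNReal.ofReal (gnomonicWeight z * Real.exp (-(κ * normSq3 z / (1 + normSq3 z))))) z ≤
      ENNReal.ofReal ((2 * π / κ) ^ ((3 : ℝ) / 2)) := by
  have hκ2 : 0 < κ / 2 := by linarith
  have hpt : ∀ z : Fin 3 → ℝ, {z : Fin 3 → ℝ | normSq3 z ≤ R ^ 2}.indicator
      (fun z => ENNReal.ofReal (gnomonicWeight z * Real.exp (-(κ * normSq3 z / (1 + normSq3 z))))) z ≤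
      ENNReal.ofReal (Real.exp (-(κ / 2 * normSq3 z))) := by
    intro z
    by_cases hz : z ∈ {z : Fin 3 → ℝ | normSq3 z ≤ R ^ 2}
    · rw [Set.indicator_of_mem hz]
      exact ENNReal.ofReal_le_ofReal (tipZ_integrand_le hκ.le hR0 hR hz)
    · rw [Set.indicator_of_notMem hz]; exact bot_le
  calc ∫⁻ z : Fin 3 → ℝ, {z : Fin 3 → ℝ | normSq3 z ≤ R ^ 2}.indicator
        (fun z => ENNReal.ofReal (gnomonicWeight z * Real.exp (-(κ * normSq3 z / (1 + normSq3 z))))) z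
      ≤ ∫⁻ z : Fin 3 → ℝ, ENNReal.ofReal (Real.exp (-(κ / 2 * normSq3 z))) := lintegral_mono hpt
    _ = ENNReal.ofReal ((π / (κ / 2)) ^ ((3 : ℝ) / 2)) := lintegral_exp_neg_mul_normSq3 hκ2
    _ = ENNReal.ofReal ((2 * π / κ) ^ ((3 : ℝ) / 2)) := by
        congr 2
        field_simp

/-- §2 restricted form: `∫⁻_{normSq3 z ≤ R²} ofReal(w(z)·e^{−κ|z|²/(1+|z|²)}) ≤ ofReal((2π/κ)^{3/2})` for `κ > 0`, `R ≤ 1`. [folklore] -/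
theorem setLIntegral_tipZ_le {κ R : ℝ} (hκ : 0 < κ) (hR0 : 0 ≤ R) (hR : R ≤ 1) :
    ∫⁻ z in {z : Fin 3 → ℝ | normSq3 z ≤ R ^ 2}, ENNReal.ofReal (gnomonicWeight z * Real.exp (-(κ * normSq3 z / (1 + normSq3 z)))) ≤
      ENNReal.ofReal ((2 * π / κ) ^ ((3 : ℝ) / 2)) := by
  have hm : MeasurableSet {z : Fin 3 → ℝ | normSq3 z ≤ R ^ 2} := by
    unfold normSq3
    exact measurableSet_le (by fun_prop) (by fun_prop)
  rw [← lintegral_indicator hm]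
  exact tipZ_factor_le hκ hR0 hR

/-- §2 unrestricted comparison form: if `f ≤ 𝟙_{normSq3 ≤ R²}·w·e^{−κ|z|²/(1+|z|²)}` pointwise then `∫⁻ f ≤ ofReal((2π/κ)^{3/2})`. [folklore] -/
theorem lintegral_le_tipZ_of_le {κ R : ℝ} (hκ : 0 < κ) (hR0 : 0 ≤ R) (hR : R ≤ 1) {f : (Fin 3 → ℝ) → ℝ≥0∞}
    (hf : ∀ z, f z ≤ {z : Fin 3 → ℝ | normSq3 z ≤ R ^ 2}.indicator
      (fun z => ENNReal.ofReal (gnomonicWeight z * Real.exp (-(κ * normSq3 z / (1 + normSq3 z))))) z) :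
    ∫⁻ z : Fin 3 → ℝ, f z ≤ ENNReal.ofReal ((2 * π / κ) ^ ((3 : ℝ) / 2)) :=
  (lintegral_mono hf).trans (tipZ_factor_le hκ hR0 hR)

end Summit.QuantumFields.YangMills.Theorems.SwapVirialDeficit.SectorLaplace

end
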